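import Summits.NavierStokesRegularity.NavierStokesRegularity.Theorems.AdaptedFrequencyTangentFlowTransferKernelCalculus
import Summits.NavierStokesRegularity.NavierStokesRegularity.Theorems.AdaptedFrequencyTangentFlowTransferFrequencyLimit
import Literature.Analysis.FluidPDE.HessianLaplacian
import Literature.Analysis.FluidPDE.MildSolutionProofs
import Literature.Analysis.FluidPDE.TaoEnstrophyLocalisation
import HarnessLib

/-!
# Kernel calculus, global form: `d/dt ∫ q G = ∫ (∂ₜq + u·∇q − νΔq) G` for bounded smooth `q`
# (route `AdaptedFrequency`, item `TangentFlowTransfer`, stmt-NavierStokesRegularity-10494)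

Helper file (all results proved), continuing `AdaptedFrequencyTangentFlowTransferKernelCalculus`
(the compactly supported case). Here the test field `q` is jointly smooth and **bounded together
with `∂ₜq`, `∇q`, `Δq`** on `S × E` (as the squared vorticity `‖curl u‖²` of a Type-I solution is
on every compact time window, KNSS 2009 Prop. 4.1), the drift `u` is jointly smooth, bounded and
divergence free, and the kernel `G ≥ 0` is jointly `C²`, solves the adjoint equation and is
**dominated on `S` by one integrable function** (as a Gaussian-comparable kernel is on every
compact time window). Then `t ↦ ∫ q(t) G(t)` is differentiable on `S` with
`d/dt ∫ q G = ∫ (∂ₜq + u·∇q − νΔq) G` (`hasDerivAt_integral_mul_kernel_of_bounds`).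

Proof: cut off `q` by `χ_k = cutoff (k+1)` (`Literature.Analysis.FluidPDE.cutoff`), apply the
compactly supported identity to `q χ_k`, expand
`L(q χ_k) = χ_k Lq + q (u·∇χ_k) − ν (q Δχ_k + 2 Σᵢ ∂ᵢq ∂ᵢχ_k)` (`L = ∂ₜ + u·∇ − νΔ`; Leibniz rule
`laplacian_mul_eq`), bound it uniformly (`‖∇χ_k‖ ≤ C₁`, `|Δχ_k| ≤ C₂`), and pass `k → ∞` in the
values and in the derivatives by dominated convergence (dominator: a multiple of `G(s)` at fixed
`s`), the derivative of the limit being identified by the FTC transfer lemma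
`hasDerivAt_of_tendsto_of_deriv_bound` (file `…FrequencyLimit`), whose continuity input
`s ↦ ∫ Lq(s) G(s)` comes from the uniform dominator.

References: A. Friedman, *PDE of Parabolic Type* (1964), Ch. 1 §8 (adjoint Green identity);
G. Koch, N. Nadirashvili, G. Seregin, V. Šverák, Acta Math. 203 (2009), Prop. 4.1 (derivative bounds).
-/

noncomputable section

open MeasureTheory Set Function Filter TopologicalSpace Metric
open scoped Topology NNReal ENNReal InnerProductSpace Laplacian RealInnerProductSpace

namespace Summit.NavierStokesRegularity.NavierStokesRegularity.Theorems

open Literature.Analysis Literature.Analysis.FluidPDE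

variable {E : Type*} [NormedAddCommGroup E] [InnerProductSpace ℝ E] [FiniteDimensional ℝ E]
  [MeasurableSpace E] [BorelSpace E]

/-! ### The operator `L = ∂ₜ + u·∇ − νΔ` on a product with a time-independent cut-off -/

omit [MeasurableSpace E] [BorelSpace E] in
/-- **Leibniz rule for `L = ∂ₜ + u·∇ − νΔ` against a time-independent factor `χ`**: at an
interior time `s` of the open set `S`,
`L(q χ)(s, x) = χ Lq + q (u·∇χ) − ν (q Δχ + 2 Σᵢ ∂ᵢq ∂ᵢχ)` (product rules for `∂ₜ`, `D` and
`laplacian_mul_eq`). [folklore] -/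
theorem opL_mul_const_time {ι : Type*} [Fintype ι] (b : OrthonormalBasis ι ℝ E) {ν : ℝ}
    {u : ℝ → E → E} {q : ℝ → E → ℝ} {χ : E → ℝ} (hχ : ContDiff ℝ 2 χ) {s : ℝ} {x : E}
    (hqs : ContDiff ℝ 2 (q s)) :
    deriv (fun r => q r x * χ x) s + fderiv ℝ (fun y => q s y * χ y) x (u s x) -
        ν * (Δ fun y => q s y * χ y) x =
      χ x * (deriv (fun r => q r x) s + fderiv ℝ (q s) x (u s x) - ν * (Δ (q s)) x) +
        q s x * fderiv ℝ χ x (u s x) -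
        ν * (q s x * (Δ χ) x + 2 * ∑ i, fderiv ℝ (q s) x (b i) * fderiv ℝ χ x (b i)) := by
  have hqd : DifferentiableAt ℝ (q s) x := (hqs.differentiable (by norm_num)) x
  have hχd : DifferentiableAt ℝ χ x := (hχ.differentiable (by norm_num)) x
  rw [deriv_mul_const_field, fderiv_fun_mul hqd hχd, laplacian_mul_eq b hqs hχ x]
  simp only [add_apply, FunLike.coe_smul, Pi.smul_apply, smul_eq_mul]
  ring

omit [FiniteDimensional ℝ E] [MeasurableSpace E] [BorelSpace E] in
/-- **Uniform bound for `L(q χ)`**: if `|q|, ‖Dq‖, |Lq| ≤ M`, `‖u‖ ≤ M`, `|χ| ≤ 1`, `‖Dχ‖ ≤ C₁`,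
`|Δχ| ≤ C₂`, then `|L(qχ)| ≤ M + M² C₁ + |ν| (M C₂ + 2 · card ι · M C₁)`. [folklore] -/
theorem abs_opL_mul_le {ι : Type*} [Fintype ι] (b : OrthonormalBasis ι ℝ E) {ν M C₁ C₂ : ℝ}
    {Lq qv χv Δχ : ℝ} {Dq Dχ : E →L[ℝ] ℝ} {uv : E} (hM : 0 ≤ M)
    (hLq : |Lq| ≤ M) (hq : |qv| ≤ M) (hDq : ‖Dq‖ ≤ M) (hu : ‖uv‖ ≤ M) (hχ : |χv| ≤ 1)
    (hDχ : ‖Dχ‖ ≤ C₁) (hΔχ : |Δχ| ≤ C₂) :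
    |χv * Lq + qv * Dχ uv - ν * (qv * Δχ + 2 * ∑ i, Dq (b i) * Dχ (b i))| ≤
      M + M * C₁ * M + |ν| * (M * C₂ + 2 * (Fintype.card ι) * (M * C₁)) := by
  have hC₁ : 0 ≤ C₁ := (norm_nonneg _).trans hDχ
  have h1 : |χv * Lq| ≤ M := by
    rw [abs_mul]
    calc |χv| * |Lq| ≤ 1 * M := mul_le_mul hχ hLq (abs_nonneg _) zero_le_one
      _ = M := one_mul M
  have h2 : |qv * Dχ uv| ≤ M * C₁ * M := by
    rw [abs_mul]
    have : |Dχ uv| ≤ C₁ * M := by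
      rw [← Real.norm_eq_abs]
      exact (Dχ.le_opNorm uv).trans (mul_le_mul hDχ hu (norm_nonneg _) hC₁)
    calc |qv| * |Dχ uv| ≤ M * (C₁ * M) := mul_le_mul hq this (abs_nonneg _) hM
      _ = M * C₁ * M := by ring
  have h3 : |qv * Δχ| ≤ M * C₂ := by
    rw [abs_mul]; exact mul_le_mul hq hΔχ (abs_nonneg _) hM
  have h4 : |2 * ∑ i, Dq (b i) * Dχ (b i)| ≤ 2 * (Fintype.card ι) * (M * C₁) := by
    rw [abs_mul, abs_two, mul_assoc]
    refine mul_le_mul_of_nonneg_left ?_ zero_le_two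
    calc |∑ i, Dq (b i) * Dχ (b i)| ≤ ∑ i, |Dq (b i) * Dχ (b i)| := Finset.abs_sum_le_sum_abs _ _
      _ ≤ ∑ _i : ι, M * C₁ := Finset.sum_le_sum fun i _ => by
          rw [abs_mul]
          have e1 : |Dq (b i)| ≤ M := by
            rw [← Real.norm_eq_abs]
            exact (Dq.le_opNorm _).trans (by rw [b.orthonormal.1 i, mul_one]; exact hDq)
          have e2 : |Dχ (b i)| ≤ C₁ := by
            rw [← Real.norm_eq_abs]
            exact (Dχ.le_opNorm _).trans (by rw [b.orthonormal.1 i, mul_one]; exact hDχ)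
          exact mul_le_mul e1 e2 (abs_nonneg _) hM
      _ = (Fintype.card ι) * (M * C₁) := by simp
  calc |χv * Lq + qv * Dχ uv - ν * (qv * Δχ + 2 * ∑ i, Dq (b i) * Dχ (b i))|
      ≤ |χv * Lq + qv * Dχ uv| + |ν * (qv * Δχ + 2 * ∑ i, Dq (b i) * Dχ (b i))| := abs_sub _ _
    _ ≤ (|χv * Lq| + |qv * Dχ uv|) + |ν| * (|qv * Δχ| + |2 * ∑ i, Dq (b i) * Dχ (b i)|) := by
        gcongr
        · exact abs_add_le _ _
        · rw [abs_mul]; gcongr; exact abs_add_le _ _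
    _ ≤ (M + M * C₁ * M) + |ν| * (M * C₂ + 2 * (Fintype.card ι) * (M * C₁)) := by
        gcongr
    _ = M + M * C₁ * M + |ν| * (M * C₂ + 2 * (Fintype.card ι) * (M * C₁)) := by ring

/-! ### The global first-variation identity -/

/-- **First variation against a dominated adapted kernel, for bounded smooth test fields.** Let
`S` be an open set of times; `G : ℝ → E → ℝ` jointly `C²` on `S × E`, nonnegative, solving the
adjoint equation `∂ₜG + u·∇G + νΔG = 0` on `S × E`, and dominated there by one integrable function
`Φ₀` (`G(s, x) ≤ Φ₀(x)`); `u` jointly smooth on `S × E`, divergence free and bounded by `M`; `q`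
jointly smooth on `S × E` with `|q|, ‖Dq‖, |Δq|, |∂ₜq| ≤ M`. Then for every `t ∈ S`,

  `d/dt ∫ q(t, x) G(t, x) dx = ∫ (∂ₜq + u·∇q − νΔq)(t, x) G(t, x) dx`.

(Cut-off `q χ_k`, the compactly supported identity `hasDerivAt_integral_mul_adaptedKernel`,
uniform bounds `abs_opL_mul_le`, dominated convergence in `k` at fixed times, and the FTC transfer
`hasDerivAt_of_tendsto_of_deriv_bound`; Friedman 1964, Ch. 1 §8.) [folklore] -/
theorem hasDerivAt_integral_mul_kernel_of_bounds {ν : ℝ} {u : ℝ → E → E} {S : Set ℝ}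
    {G q : ℝ → E → ℝ} (hS : IsOpen S) (hG : ContDiffOn ℝ 2 (uncurry G) (S ×ˢ univ))
    (hadj : ∀ t ∈ S, ∀ x,
      timeDerivWithin S G t x + fderiv ℝ (G t) x (u t x) + ν * (Δ (G t)) x = 0)
    (hG0 : ∀ t ∈ S, ∀ x, 0 ≤ G t x) {Φ₀ : E → ℝ} (hΦ₀ : Integrable Φ₀ (volume : Measure E))
    (hdom : ∀ t ∈ S, ∀ x, G t x ≤ Φ₀ x)
    (hu : IsSmoothSpaceTimeOn S u) (hdiv : ∀ t ∈ S, ∀ x, VectorCalculus.divergence (u t) x = 0)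
    (hq : IsSmoothSpaceTimeOn S q) {M : ℝ}
    (hbd : ∀ t ∈ S, ∀ x, |q t x| ≤ M ∧ ‖fderiv ℝ (q t) x‖ ≤ M ∧ |(Δ (q t)) x| ≤ M ∧
      |timeDerivWithin S q t x| ≤ M ∧ ‖u t x‖ ≤ M)
    {t : ℝ} (ht : t ∈ S) :
    HasDerivAt (fun s => ∫ x, q s x * G s x)
      (∫ x, (timeDerivWithin S q t x + fderiv ℝ (q t) x (u t x) - ν * (Δ (q t)) x) * G t x) t := by
  have hUd : UniqueDiffOn ℝ S := hS.uniqueDiffOn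
  set b := stdOrthonormalBasis ℝ E with hb
  set n : ℕ := Module.finrank ℝ E with hn
  -- nonnegativity of `M` (the set `S` is nonempty)
  have hM : 0 ≤ M := (abs_nonneg _).trans (hbd t ht 0).1
  -- the operator `L` applied to `q`, as a jointly smooth field
  set Lq : ℝ → E → ℝ := fun s x =>
    timeDerivWithin S q s x + fderiv ℝ (q s) x (u s x) - ν * (Δ (q s)) x with hLq
  have hLq_smooth : IsSmoothSpaceTimeOn S Lq := by
    have h1 : IsSmoothSpaceTimeOn S (timeDerivWithin S q) := hq.timeDerivWithin hUd
    have h2 : IsSmoothSpaceTimeOn S (fun s x => fderiv ℝ (q s) x (u s x)) :=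
      (hq.fderiv_slice hUd).clm_apply hu
    have h3 : IsSmoothSpaceTimeOn S (fun s x => (Δ (q s)) x) := hq.laplacian hUd
    exact (h1.add h2).sub (h3.const_smul ν)
  have hLq_bd : ∀ s ∈ S, ∀ x, |Lq s x| ≤ M + M * M + |ν| * M := by
    intro s hs x
    obtain ⟨h1, h2, h3, h4, h5⟩ := hbd s hs x
    have e2 : |fderiv ℝ (q s) x (u s x)| ≤ M * M := by
      rw [← Real.norm_eq_abs]
      exact ((fderiv ℝ (q s) x).le_opNorm _).trans (mul_le_mul h2 h5 (norm_nonneg _) hM)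
    calc |Lq s x| ≤ |timeDerivWithin S q s x + fderiv ℝ (q s) x (u s x)| + |ν * (Δ (q s)) x| :=
          abs_sub _ _
      _ ≤ (|timeDerivWithin S q s x| + |fderiv ℝ (q s) x (u s x)|) + |ν| * |(Δ (q s)) x| := by
          rw [abs_mul]; gcongr; exact abs_add_le _ _
      _ ≤ (M + M * M) + |ν| * M := by gcongr
  -- slices
  have hGc : ∀ s ∈ S, Continuous (G s) := fun s hs =>
    (contDiff_slice_of_contDiffOn_prod_univ hG hs).continuous
  have hGi : ∀ s ∈ S, Integrable (G s) (volume : Measure E) := fun s hs =>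
    hΦ₀.mono' (hGc s hs).aestronglyMeasurable (Eventually.of_forall fun x => by
      rw [Real.norm_eq_abs, abs_of_nonneg (hG0 s hs x)]; exact hdom s hs x)
  have hqc2 : ∀ s ∈ S, ContDiff ℝ 2 (q s) := fun s hs => (hq.contDiff_slice hs).of_le (by norm_cast)
  have hLqc : ∀ s ∈ S, Continuous (Lq s) := fun s hs => (hLq_smooth.contDiff_slice hs).continuous
  -- the cut-offs
  obtain ⟨C₁, hC₁0, hC₁⟩ := exists_norm_fderiv_cutoff_le (E := E)
  obtain ⟨C₂, hC₂0, hC₂⟩ := exists_abs_laplacian_cutoff_le (E := E)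
  set χ : ℕ → E → ℝ := fun k => cutoff ((k : ℝ) + 1) with hχ
  have hk1 : ∀ k : ℕ, (0 : ℝ) < (k : ℝ) + 1 := fun k => by positivity
  have hχs : ∀ k, ContDiff ℝ ((⊤ : ℕ∞) : WithTop ℕ∞) (χ k) := fun k => contDiff_cutoff _
  have hχ2 : ∀ k, ContDiff ℝ 2 (χ k) := fun k => contDiff_cutoff _
  have hχle : ∀ k x, |χ k x| ≤ 1 := fun k x => abs_cutoff_le_one _ _
  have hDχ : ∀ k x, ‖fderiv ℝ (χ k) x‖ ≤ C₁ := fun k x => by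
    refine (hC₁ _ (hk1 k) x).trans ?_
    rw [div_le_iff₀ (hk1 k)]
    nlinarith [(Nat.cast_nonneg k : (0 : ℝ) ≤ k)]
  have hΔχ : ∀ k x, |(Δ (χ k)) x| ≤ C₂ := fun k x => by
    refine (hC₂ _ (hk1 k) x).trans ?_
    rw [div_le_iff₀ (by positivity)]
    have : (1 : ℝ) ≤ ((k : ℝ) + 1) ^ 2 := by nlinarith [(Nat.cast_nonneg k : (0 : ℝ) ≤ k)]
    nlinarith
  -- the cut-off test fields
  set qk : ℕ → ℝ → E → ℝ := fun k s x => q s x * χ k x with hqk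
  have hqk_smooth : ∀ k, IsSmoothSpaceTimeOn S (qk k) := fun k =>
    hq.mul (isSmoothSpaceTimeOn_const_time (hχs k) S)
  have hqk_supp : ∀ k : ℕ, ∀ s ∈ S, ∀ x ∉ closedBall (0 : E) (2 * ((k : ℝ) + 1)), qk k s x = 0 := by
    intro k s hs x hx
    rw [mem_closedBall_zero_iff, not_le] at hx
    simp only [hqk, hχ, cutoff_eq_zero (hk1 k) hx.le, mul_zero, MulZeroClass.mul_zero]
  -- the compactly supported identity for each `k`, at every time of `S`
  have hHk : ∀ k, ∀ s ∈ S, HasDerivAt (fun r => ∫ x, qk k r x * G r x)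
      (∫ x, (deriv (fun r => qk k r x) s + fderiv ℝ (qk k s) x (u s x) - ν * (Δ (qk k s)) x) *
        G s x) s := fun k s hs =>
    hasDerivAt_integral_mul_adaptedKernel hS hG hadj
      (fun r hr => (hu.contDiff_slice hr).of_le (by norm_cast)) hdiv
      ((hqk_smooth k).of_le (by norm_cast)) (isCompact_closedBall _ _) (hqk_supp k) hs
  -- the expansion of `L(q χ_k)` and its uniform bound
  set A : ℝ := (M + M * M + |ν| * M) + (M + M * M + |ν| * M) * C₁ * (M + M * M + |ν| * M) +
    |ν| * ((M + M * M + |ν| * M) * C₂ + 2 * (Fintype.card (Fin n)) *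
      ((M + M * M + |ν| * M) * C₁)) with hA
  have hexp : ∀ k, ∀ s ∈ S, ∀ x,
      deriv (fun r => qk k r x) s + fderiv ℝ (qk k s) x (u s x) - ν * (Δ (qk k s)) x =
        χ k x * Lq s x + q s x * fderiv ℝ (χ k) x (u s x) -
          ν * (q s x * (Δ (χ k)) x + 2 * ∑ i, fderiv ℝ (q s) x (b i) * fderiv ℝ (χ k) x (b i)) := by
    intro k s hs x
    have e := opL_mul_const_time b (ν := ν) (u := u) (hχ2 k) (hqc2 s hs) (x := x)
    simp only [hqk]
    rw [e]
    simp only [hLq, timeDerivWithin_eq_deriv hS hs q x]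
  have hbdk : ∀ k, ∀ s ∈ S, ∀ x,
      |deriv (fun r => qk k r x) s + fderiv ℝ (qk k s) x (u s x) - ν * (Δ (qk k s)) x| ≤ A := by
    intro k s hs x
    rw [hexp k s hs x, hA]
    set M' := M + M * M + |ν| * M with hM'
    have hMM' : M ≤ M' := by rw [hM']; nlinarith [abs_nonneg ν]
    obtain ⟨h1, h2, h3, h4, h5⟩ := hbd s hs x
    exact abs_opL_mul_le b (hM.trans hMM') (hLq_bd s hs x) (h1.trans hMM') (h2.trans hMM')
      (h5.trans hMM') (hχle k x) (hDχ k x) (hΔχ k x)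
  -- pointwise limit of `L(q χ_k)`: eventually equal to `Lq`
  have hptL : ∀ s ∈ S, ∀ x, ∀ᶠ k : ℕ in atTop,
      deriv (fun r => qk k r x) s + fderiv ℝ (qk k s) x (u s x) - ν * (Δ (qk k s)) x = Lq s x := by
    intro s hs x
    have hev : ∀ᶠ k : ℕ in atTop, ‖x‖ < (k : ℝ) + 1 := by
      filter_upwards [(tendsto_natCast_atTop_atTop (R := ℝ)).eventually_gt_atTop ‖x‖] with k hk
      linarith
    filter_upwards [hev] with k hk
    rw [hexp k s hs x]
    have e1 : χ k x = 1 := cutoff_eq_one (hk1 k) hk.le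
    have e2 : fderiv ℝ (χ k) x = 0 := fderiv_cutoff_eq_zero (hk1 k) hk
    have e3 : (Δ (χ k)) x = 0 := laplacian_cutoff_eq_zero (hk1 k) hk
    rw [e1, e2, e3]
    simp
  -- (c) values: `∫ q χ_k G → ∫ q G` at every time of `S`
  have hval : ∀ s ∈ S, Tendsto (fun k => ∫ x, qk k s x * G s x) atTop (𝓝 (∫ x, q s x * G s x)) := by
    intro s hs
    refine tendsto_integral_of_dominated_convergence (fun x => M * G s x) ?_ ((hGi s hs).const_mul M)
      ?_ ?_
    · intro k
      exact (((hqk_smooth k).contDiff_slice hs).continuous.mul (hGc s hs)).aestronglyMeasurable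
    · intro k
      refine Eventually.of_forall fun x => ?_
      rw [Real.norm_eq_abs, abs_mul, abs_of_nonneg (hG0 s hs x)]
      refine mul_le_mul_of_nonneg_right ?_ (hG0 s hs x)
      simp only [hqk, abs_mul]
      calc |q s x| * |χ k x| ≤ M * 1 := mul_le_mul (hbd s hs x).1 (hχle k x) (abs_nonneg _) hM
        _ = M := mul_one M
    · refine Eventually.of_forall fun x => ?_
      have : Tendsto (fun k : ℕ => χ k x) atTop (𝓝 1) := tendsto_cutoff_natCast_add_one x
      simpa [hqk] using (tendsto_const_nhds.mul this).mul tendsto_const_nhds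
  -- (d) derivatives: `∫ L(q χ_k) G → ∫ Lq G` at every time of `S`
  have hder : ∀ s ∈ S, Tendsto (fun k => ∫ x,
      (deriv (fun r => qk k r x) s + fderiv ℝ (qk k s) x (u s x) - ν * (Δ (qk k s)) x) * G s x)
      atTop (𝓝 (∫ x, Lq s x * G s x)) := by
    intro s hs
    refine tendsto_integral_of_dominated_convergence (fun x => A * G s x) ?_ ((hGi s hs).const_mul A)
      ?_ ?_
    · intro k
      have hc1 : Continuous fun x => deriv (fun r => qk k r x) s := by
        have := ((hqk_smooth k).isSmoothSpaceTimeOn_deriv hS).contDiff_slice hs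
        exact this.continuous
      have hc2 : Continuous fun x => fderiv ℝ (qk k s) x (u s x) :=
        ((((hqk_smooth k).contDiff_slice hs).of_le (by norm_cast) : ContDiff ℝ 1 (qk k s)).continuous_fderiv
          one_ne_zero).clm_apply (hu.contDiff_slice hs).continuous
      have hc3 : Continuous fun x => (Δ (qk k s)) x :=
        continuous_laplacian (((hqk_smooth k).contDiff_slice hs).of_le (by norm_cast))
      exact (((hc1.add hc2).sub (continuous_const.mul hc3)).mul (hGc s hs)).aestronglyMeasurable
    · intro k
      refine Eventually.of_forall fun x => ?_
      rw [Real.norm_eq_abs, abs_mul, abs_of_nonneg (hG0 s hs x)]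
      exact mul_le_mul_of_nonneg_right (hbdk k s hs x) (hG0 s hs x)
    · refine Eventually.of_forall fun x => ?_
      refine (tendsto_const_nhds (x := Lq s x * G s x)).congr' ?_
      filter_upwards [hptL s hs x] with k hk
      rw [hk]
  -- (b) uniform bound on the derivatives
  have hDbd : ∀ k, ∀ s ∈ S, |deriv (fun r => ∫ x, qk k r x * G r x) s| ≤ A * ∫ x, Φ₀ x := by
    intro k s hs
    rw [(hHk k s hs).deriv]
    have hi : Integrable (fun x => A * G s x) (volume : Measure E) := (hGi s hs).const_mul A
    calc |∫ x, (deriv (fun r => qk k r x) s + fderiv ℝ (qk k s) x (u s x) - ν * (Δ (qk k s)) x) *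
          G s x|
        ≤ ∫ x, |(deriv (fun r => qk k r x) s + fderiv ℝ (qk k s) x (u s x) - ν * (Δ (qk k s)) x) *
          G s x| := abs_integral_le_integral_abs
      _ ≤ ∫ x, A * G s x := by
          refine integral_mono_of_nonneg (Eventually.of_forall fun x => abs_nonneg _) hi
            (Eventually.of_forall fun x => ?_)
          show |(deriv (fun r => qk k r x) s + fderiv ℝ (qk k s) x (u s x) - ν * (Δ (qk k s)) x) *
              G s x| ≤ A * G s x
          rw [abs_mul, abs_of_nonneg (hG0 s hs x)]
          exact mul_le_mul_of_nonneg_right (hbdk k s hs x) (hG0 s hs x)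
      _ = A * ∫ x, G s x := integral_const_mul _ _
      _ ≤ A * ∫ x, Φ₀ x := by
          have hA0 : 0 ≤ A := (abs_nonneg _).trans (hbdk 0 t ht 0)
          refine mul_le_mul_of_nonneg_left ?_ hA0
          exact integral_mono (hGi s hs) hΦ₀ fun x => hdom s hs x
  -- (e) continuity of `s ↦ ∫ Lq(s) G(s)` on `S`
  have hgc : ContinuousOn (fun s => ∫ x, Lq s x * G s x) S := by
    have hA' : ∀ s ∈ S, ∀ x, |Lq s x * G s x| ≤ (M + M * M + |ν| * M) * Φ₀ x := fun s hs x => by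
      rw [abs_mul, abs_of_nonneg (hG0 s hs x)]
      exact mul_le_mul (hLq_bd s hs x) (hdom s hs x) (hG0 s hs x)
        ((abs_nonneg _).trans (hLq_bd s hs x))
    refine continuousOn_of_dominated (bound := fun x => (M + M * M + |ν| * M) * Φ₀ x) ?_ ?_
      (hΦ₀.const_mul _) ?_
    · intro s hs
      exact ((hLqc s hs).mul (hGc s hs)).aestronglyMeasurable
    · intro s hs
      exact Eventually.of_forall fun x => by rw [Real.norm_eq_abs]; exact hA' s hs x
    · refine Eventually.of_forall fun x => ?_
      have h1 : ContinuousOn (uncurry Lq) (S ×ˢ univ) := hLq_smooth.continuousOn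
      have h2 : ContinuousOn (uncurry G) (S ×ˢ univ) := hG.continuousOn
      have h3 : ContinuousOn (fun s : ℝ => ((s, x) : ℝ × E)) S := (continuous_id.prodMk continuous_const).continuousOn
      have hmaps : MapsTo (fun s : ℝ => ((s, x) : ℝ × E)) S (S ×ˢ univ) := fun s hs => ⟨hs, mem_univ x⟩
      exact (h1.comp h3 hmaps).mul (h2.comp h3 hmaps)
  -- transfer of the derivative to the limit
  have key := hasDerivAt_of_tendsto_of_deriv_bound hS (H := fun k r => ∫ x, qk k r x * G r x)
    (Hbar := fun r => ∫ x, q r x * G r x) (g := fun r => ∫ x, Lq r x * G r x)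
    (B := A * ∫ x, Φ₀ x)
    (fun k s hs => (hHk k s hs).differentiableAt) hDbd hval
    (fun s hs => by
      refine (hder s hs).congr fun k => ?_
      exact ((hHk k s hs).deriv).symm) hgc ht
  exact key

end Summit.NavierStokesRegularity.NavierStokesRegularity.Theorems

end
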